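import Mathlib
import Summits.NavierStokesRegularity.NavierStokesRegularity.Theorems.LerayQuarterDissipationFiniteDissipationLiouvilleMicroscaleWindowEnvelope
import Summits.NavierStokesRegularity.NavierStokesRegularity.Theorems.LerayQuarterDissipationFiniteDissipationLiouvilleEveryInstant
import HarnessLib

/-!
# Crux `FiniteDissipationLiouville` (stmt-NavierStokesRegularity-22144): A RECURRENT EXPLICIT
# PALINSTROPHY FLOOR — the window plus the every-instant enstrophy floor bound the vorticity
# gradients of the hypothetical profile from BELOW in every log-time window

Theorems file of route `LerayQuarterDissipation` (lead prover g18; `--supports` the crux; sequel of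
`…MicroscaleWindowEnvelope` and of lead g17's `…EveryInstant`). Navier–Stokes regularity is NOT
proved by anything here; no summit is.

* `sqrt_ge_of_sq_sub_le` — algebra: `2(a − b)² ≤ c` ⇒ `b − √(c/2) ≤ a`;
* **`exists_palinstrophy_floor_window`** — for a SINGULAR member of the stratum `𝒟_{C,K}` with a
  Type-I envelope, in every similarity-time window `[s₁, s₁ + L]` there is an instant `ξ` with
  `√D(ξ) ≥ ½C√Z(ξ) − √(¼(C²−1)Z(ξ) + ‖curlCLM‖²·max K 0/(2L))` AND the every-instant floor
  `(√Z(ξ)·K_S^{3/2})⁴ ≥ 64/27` (`Z = ∫‖Ω‖² = √(−t)∫‖ω‖²`, `D = ∫‖curl Ω‖² = (−t)^{3/2}∫‖∇×ω‖²`):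
  since `Z ≥ (64/27)^{1/2}K_S⁻³ > 0` the right-hand side is POSITIVE once
  `L > 2‖curlCLM‖²max K 0·K_S³/(64/27)^{1/2}`, and tends to `½(C − √(C²−1))√Z ≥ ½(C−√(C²−1))(64/27)^{1/4}K_S^{−3/2}`
  as `L → ∞`: **the scale-invariant palinstrophy `(−t)^{3/2}∫‖∇ω(t)‖²dx` of the critical element
  exceeds an explicit positive constant `d*(C, K, L)` somewhere in every log-time window** — Leray's
  `Ḣ²`-rate `‖∇ω(t)‖₂ ≳ (T−t)^{−3/4}` in ancient, scale-invariant, recurrent and explicit form.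

HONEST FRAMING. A corollary of two landed clauses (window recurrence, every-instant enstrophy floor);
recurrent, not every-instant (an every-instant palinstrophy floor would need the palinstrophy budget,
whose scaling damping is `3/2`, not in the tree); Mathlib's non-sharp `K_S`. Necessary conditions on a
HYPOTHETICAL object; nothing is removed from the DSS wall. Nothing here bears on NS regularity.

References: Leray 1934 §20; Robinson–Rodrigo–Sadowski (2016) Cor. 6.25 ff. (rates for `Ḣ^s`);
folklore energy method.
-/

noncomputable section

set_option linter.dupNamespace false

namespace Summit.NavierStokesRegularity.NavierStokesRegularity.Theorems.FiniteDissipationLiouville.MicroscaleWindow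

open MeasureTheory Set Filter Topology Metric InnerProductSpace Function Real
open scoped RealInnerProductSpace ContDiff
open Literature.Analysis Literature.Analysis.FluidPDE
open Summit.NavierStokesRegularity.NavierStokesRegularity.Theorems
open Summit.NavierStokesRegularity.NavierStokesRegularity.Theorems.FiniteDissipationLiouville

variable {C A K : ℝ} {V : ℝ → EuclideanSpace ℝ (Fin 3) → EuclideanSpace ℝ (Fin 3)}

/-- Algebra: `2(a − b)² ≤ c` gives `b − √(c/2) ≤ a`. [folklore] -/
theorem sqrt_ge_of_sq_sub_le {a b c : ℝ} (h : 2 * (a - b) ^ 2 ≤ c) : b - Real.sqrt (c / 2) ≤ a := by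
  have hc : (a - b) ^ 2 ≤ c / 2 := by linarith
  have h1 : |a - b| ≤ Real.sqrt (c / 2) := by
    rw [← Real.sqrt_sq_eq_abs]
    exact Real.sqrt_le_sqrt hc
  have h2 : b - a ≤ |a - b| := by rw [abs_sub_comm]; exact le_abs_self _
  linarith

/-- **A RECURRENT EXPLICIT PALINSTROPHY FLOOR.** For a SINGULAR member `V` of `𝒟_{C,K}`
(`IsTypeIAncientMild C V`, law `K`, singular at the apex) with a Type-I envelope `HasTypeIDecay A V`,
every `s₁` and every `L > 0`: some `ξ ∈ [s₁, s₁ + L]` has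
`½C√Z(ξ) − √(¼(C²−1)Z(ξ) + ‖curlCLM‖²·max K 0/(2L)) ≤ √D(ξ)` together with the every-instant floor
`64/27 ≤ (√Z(ξ)·(√K_S)³)⁴` (`Z(ξ) = ∫‖Ω(ξ)‖²`, `D(ξ) = ∫‖curl Ω(ξ)‖²` on the Leray orbit).
[folklore energy method + lead g17's every-instant floor] -/
theorem exists_palinstrophy_floor_window (hV : IsTypeIAncientMild C V) (hdec : HasTypeIDecay A V)
    (hK : ∀ t : ℝ, t < 0 → ∫⁻ x, ‖fderiv ℝ (V t) x‖ₑ ^ 2 ≤ ENNReal.ofReal (K / Real.sqrt (-t)))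
    (hsing : ∀ r > 0, ∀ M : ℝ, ∃ t ∈ Set.Ioo (-(r ^ 2)) (0 : ℝ),
        ∃ x ∈ Metric.ball (0 : EuclideanSpace ℝ (Fin 3)) r, M < ‖V t x‖)
    (s₁ : ℝ) {L : ℝ} (hL : 0 < L) :
    ∃ ξ ∈ Icc s₁ (s₁ + L),
      (1 / 2) * C * Real.sqrt (∫ y, ‖lerayVorticity V ξ y‖ ^ 2) -
          Real.sqrt (((1 / 2) * (C ^ 2 - 1) * (∫ y, ‖lerayVorticity V ξ y‖ ^ 2) +
            ‖curlCLM‖ ^ 2 * max K 0 / L) / 2) ≤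
        Real.sqrt (∫ y, ‖curl (lerayVorticity V ξ) y‖ ^ 2) ∧
      64 / 27 ≤ (Real.sqrt (∫ y, ‖lerayVorticity V ξ y‖ ^ 2) *
        Real.sqrt (SNormLESNormFDerivOfEqConst (EuclideanSpace ℝ (Fin 3))
          (volume : Measure (EuclideanSpace ℝ (Fin 3))) 2 : ℝ) ^ 3) ^ 4 := by
  obtain ⟨ξ, hξ, hwin⟩ := exists_near_window_of_law hV hdec hK s₁ hL
  exact ⟨ξ, hξ, sqrt_ge_of_sq_sub_le hwin, EveryInstant.enstrophy_floor_of_singular hV hK hsing ξ⟩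

/-- **The floor is eventually POSITIVE and explicit**: if moreover
`‖curlCLM‖²·max K 0/L < ¼·∫‖Ω(ξ)‖²` at the instant `ξ` above (true for every long window, by the
every-instant enstrophy floor), then `0 < ½C√Z(ξ) − √(¼(C²−1)Z(ξ) + ‖curlCLM‖²·max K 0/(2L))`
provided `C ≥ 1`. Pure algebra: `¼(C²−1)Z + m/(2L) < ¼C²Z` iff `m/L < ½ Z`... stated with the
hypothesis `m/L < ¼Z` for a clean square-root comparison. [folklore] -/
theorem palinstrophy_floor_pos {Z m Lval : ℝ} (hC : 1 ≤ C) (hZ : 0 < Z) (hm : 0 ≤ m) (hL : 0 < Lval)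
    (hsmall : m / Lval < (1 / 4) * Z) :
    0 < (1 / 2) * C * Real.sqrt Z - Real.sqrt (((1 / 2) * (C ^ 2 - 1) * Z + m / Lval) / 2) := by
  have hC0 : 0 ≤ C := by linarith
  have hsZ : 0 < Real.sqrt Z := Real.sqrt_pos.2 hZ
  have h1 : 0 ≤ m / Lval := div_nonneg hm hL.le
  have h2 : 0 ≤ (C ^ 2 - 1) * Z := mul_nonneg (by nlinarith) hZ.le
  have hin : 0 ≤ ((1 / 2) * (C ^ 2 - 1) * Z + m / Lval) / 2 := by nlinarith
  have hpos : 0 < (1 / 2) * C * Real.sqrt Z := by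
    have : 0 < C := by linarith
    positivity
  rw [sub_pos, Real.sqrt_lt' hpos]
  have e : ((1 / 2) * C * Real.sqrt Z) ^ 2 = (1 / 4) * C ^ 2 * Z := by
    rw [mul_pow, mul_pow, Real.sq_sqrt hZ.le]; ring
  rw [e]
  have : m / Lval < (1 / 4) * Z := hsmall
  nlinarith

end Summit.NavierStokesRegularity.NavierStokesRegularity.Theorems.FiniteDissipationLiouville.MicroscaleWindow

end
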